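import Summits.BirchSwinnertonDyer.Rank1Residual.Additive.DisegniLineLeadingCoeff
import Summits.BirchSwinnertonDyer.Rank1Residual.Additive.DisegniLinePointwiseOdd
import Summits.BirchSwinnertonDyer.Rank1Residual.Additive.ChiBranchConstantTermOdd
import Literature.NumberTheory.EllipticCurves.PAdicLFunctionMinusBranchInterpolationProofs
import Literature.NumberTheory.EllipticCurves.PAdicLFunctionMinusDenominatorsProofs
import Literature.NumberTheory.EllipticCurves.PAdicLFunctionNeZeroProofs
import HarnessLib

/-!
# STEP B⁻(2) (odd branch, `p ≡ 3 (mod 4)`): the first coefficient of Disegni's line function is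
# `c⁻ · [T¹]L⁻_p(f_V, α, ω^{(p−1)/2}) · L⁻_p(f_{V′}, α, ω^{(p−1)/2})(0)` (cell `bsd-addord`, seat `bsd-addord-gz` gen 4)

HONEST FRAMING (cell `bsd-addord`; PARTITION (D-0054): EXCLUDED-DOMAIN additive rows §E, B6 = O7-ord r1 ×
every consumer of hFact, rows `p ≡ 3 (mod 4)` — types-the-object-of; booked 0). THEOREMS ONLY. Odd twin of
`DisegniLineLeadingCoeff` (STEP B(2)) with the MINUS branches `padicLFunctionMinusBranch` (interpolation
and boundedness from the tree's minus-measure theorems, constant term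
`constantCoeff_padicLFunctionMinusBranch_half`), STEP B⁻(1) and the same bounded-interpolant uniqueness.

References: [Disegni2017] Thm. A, Lemma 10.2.1; [MazurTateTeitelbaum1986Invent] §I.11–I.14.
-/

set_option autoImplicit false

noncomputable section

open scoped Classical MatrixGroups ModularForm NumberField

open CongruenceSubgroup WeierstrassCurve Literature.NumberTheory.EllipticCurves
  Literature.NumberTheory.EllipticCurves.ModularForms
  Literature.NumberTheory.EllipticCurves.Disegni2017

namespace Summit.BirchSwinnertonDyer.Rank1Residual.Additive

section LeadingCoeffOdd

variable {p : ℕ} [hp : Fact p.Prime] (ι : PadicAlgCl p ≃+* ℂ)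
  (K : Type) [Field K] [NumberField K] [IsGalois ℚ K]

/-- **The minus branches of the newform of a good ordinary curve are bounded** (MTT §I.12; distribution
relation and boundedness of `μ⁻_{f,α}` from the tree: `msdMinusMeasure_distribution_of_isNewformOf`,
`exists_norm_msdMinusMeasure_le_of_maninDrinfeld`). [cite: MazurTateTeitelbaum1986Invent, §I.12–I.13] -/
theorem exists_norm_coeff_padicLFunctionMinusBranch_le_of_isNewformOf {V : WeierstrassCurve ℚ}
    [V.IsElliptic] [V.IsGloballyMinimal] (hord : IsOrdinaryAt V p) {N : ℕ} [NeZero N]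
    {g : CuspForm (Gamma0 N) 2} (hg : IsNewformOf V g) (i : ℕ) :
    ∃ C : ℝ, ∀ k : ℕ,
      ‖PowerSeries.coeff k (padicLFunctionMinusBranch g (unitRoot V p : ℚ_[p]) i)‖ ≤ C := by
  obtain ⟨C, hC⟩ := exists_norm_msdMinusMeasure_le_of_maninDrinfeld (p := p)
    (exists_nsmul_modularSymbol_mem_periodLattice_of_isNewformOf hg) (unitRoot_coe_spec hord).2.1
  exact ⟨C, fun k ↦ norm_coeff_padicLFunctionMinusBranch_le g _
    (msdMinusMeasure_distribution_of_isNewformOf p V hord hg) hC i k⟩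

/-- **Interpolation of the minus `ω^i`-branch of the newform of a good ordinary curve** at every
primitive character of `Γ` of conductor `p^{m+1}` (MTT §I.14 (14.3); the tree's
`hasSum_padicLMinusBranchCoeff_mul_pow_of_isPrimitive` fed with the newform's distribution relation and
boundedness). [cite: MazurTateTeitelbaum1986Invent, §I.14 (14.3)] -/
theorem hasSum_coeff_padicLFunctionMinusBranch_mul_pow_of_isNewformOf {V : WeierstrassCurve ℚ}
    [V.IsElliptic] [V.IsGloballyMinimal] (hord : IsOrdinaryAt V p) {N : ℕ} [NeZero N]
    {g : CuspForm (Gamma0 N) 2} (hg : IsNewformOf V g) (i : ℕ) {m : ℕ} (hm : cyclotomicExponent p ≤ m)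
    (κ : DirichletCharacter ℂ_[p] (p ^ (m + 1))) (hκ : κ.IsPrimitive) (heven : κ.Even)
    (hord' : ∃ j : ℕ, orderOf κ = p ^ j) :
    HasSum (fun k : ℕ ↦ algebraMap ℚ_[p] ℂ_[p]
          (PowerSeries.coeff k (padicLFunctionMinusBranch g (unitRoot V p : ℚ_[p]) i)) *
        (κ (cyclotomicGenerator p : ZMod (p ^ (m + 1))) - 1) ^ k)
      (algebraMap ℚ_[p] ℂ_[p] ((unitRoot V p : ℚ_[p])⁻¹ ^ (m + 1)) *
        ∑ a : ZMod (p ^ (m + 1)), κ a *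
          algebraMap ℚ_[p] ℂ_[p] (teichWeight p i (ZMod.castHom (pow_dvd_pow p (hm.trans m.le_succ))
            (ZMod (p ^ cyclotomicExponent p)) a)) *
          (ratMinusSymbol g ((a.val : ℚ) / ((p ^ (m + 1) : ℕ) : ℚ)) : ℂ_[p])) := by
  obtain ⟨C, hC⟩ := exists_norm_msdMinusMeasure_le_of_maninDrinfeld (p := p)
    (exists_nsmul_modularSymbol_mem_periodLattice_of_isNewformOf hg) (unitRoot_coe_spec hord).2.1
  simp only [coeff_padicLFunctionMinusBranch]
  exact hasSum_padicLMinusBranchCoeff_mul_pow_of_isPrimitive g _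
    (msdMinusMeasure_distribution_of_isNewformOf p V hord hg) hC i hm κ hκ heven hord'


/-- **The MINUS value `v⁻_g(𝟙)` at level `p` is `α⁻¹ · ∑_{a mod p} (a/p)[a/p]⁻_g = L⁻_p(g, α, ω^{(p−1)/2}, 0)`**
(the tree's `constantCoeff_padicLFunctionMinusBranch_half`, re-indexed from `ZMod (p^1)` to `ZMod p`).
[cite: MazurTateTeitelbaum1986Invent, §I.14 (14.3)] -/
theorem minusBranchValue_one_eq_constantCoeff (hp2 : p ≠ 2) (hm : cyclotomicExponent p ≤ 0 + 1)
    (V : WeierstrassCurve ℚ) [V.IsElliptic] [V.IsGloballyMinimal] (hord : IsOrdinaryAt V p)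
    {N : ℕ} [NeZero N] {g : CuspForm (Gamma0 N) 2} (hg : IsNewformOf V g) :
    algebraMap ℚ_[p] ℂ_[p] ((unitRoot V p : ℚ_[p])⁻¹ ^ (0 + 1)) *
        ∑ b : ZMod (p ^ (0 + 1)),
          (1 : DirichletCharacter ℂ_[p] (p ^ (0 + 1))) b *
            algebraMap ℚ_[p] ℂ_[p] (teichWeight p (p / 2)
              (ZMod.castHom (pow_dvd_pow p hm) (ZMod (p ^ cyclotomicExponent p)) b)) *
            (ratMinusSymbol g ((b.val : ℚ) / ((p ^ (0 + 1) : ℕ) : ℚ)) : ℂ_[p]) =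
      algebraMap ℚ_[p] ℂ_[p]
        (PowerSeries.constantCoeff (padicLFunctionMinusBranch g (unitRoot V p : ℚ_[p]) (p / 2))) := by
  have hpP : p.Prime := hp.out
  rw [constantCoeff_padicLFunctionMinusBranch_half p hp2 V hord hg, map_mul]
  have hα : algebraMap ℚ_[p] ℂ_[p] ((unitRoot V p : ℚ_[p])⁻¹ ^ (0 + 1)) =
      algebraMap ℚ_[p] ℂ_[p] (unitRoot V p : ℚ_[p])⁻¹ := by
    rw [zero_add, pow_one]
  rw [hα]
  congr 1
  have hp1 : ((p ^ (0 + 1) : ℕ) : ℚ) = (p : ℚ) := by rw [zero_add, pow_one]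
  -- each summand: `𝟙(b)·(b/p)·[b/p] = (b/p)·[b/p]` (non-units have `(b/p) = 0`)
  have hsummand : ∀ b : ZMod (p ^ (0 + 1)),
      (1 : DirichletCharacter ℂ_[p] (p ^ (0 + 1))) b *
          algebraMap ℚ_[p] ℂ_[p] (teichWeight p (p / 2)
            (ZMod.castHom (pow_dvd_pow p hm) (ZMod (p ^ cyclotomicExponent p)) b)) *
          (ratMinusSymbol g ((b.val : ℚ) / ((p ^ (0 + 1) : ℕ) : ℚ)) : ℂ_[p]) =
        algebraMap ℚ_[p] ℂ_[p] (((legendreSym p (b.val : ℤ) : ℚ) *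
          ratMinusSymbol g ((b.val : ℚ) / p) : ℚ) : ℚ_[p]) := by
    intro b
    rw [teichWeight_half_castHom p hp2 hm b, hp1]
    by_cases hb : IsUnit b
    · rw [MulChar.one_apply hb, one_mul]
      push_cast
      simp only [map_intCast]
    · have hcop : ¬ Nat.Coprime b.val (p ^ (0 + 1)) := by
        intro h; apply hb
        have hu := (ZMod.isUnit_iff_coprime b.val (p ^ (0 + 1))).mpr h
        rwa [ZMod.natCast_zmod_val] at hu
      have hdvdN : p ∣ b.val := by
        by_contra hnd
        exact hcop (Nat.Coprime.pow_right _ ((Nat.Prime.coprime_iff_not_dvd hpP).mpr hnd).symm)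
      have hz : ((b.val : ℤ) : ZMod p) = 0 :=
        (ZMod.intCast_zmod_eq_zero_iff_dvd _ p).mpr (by exact_mod_cast hdvdN)
      have h0 : legendreSym p (b.val : ℤ) = 0 := (legendreSym.eq_zero_iff p _).mpr hz
      rw [MulChar.map_nonunit _ hb, h0]
      simp
  rw [Finset.sum_congr rfl fun b _ ↦ hsummand b, legendreMinusSymbolSum]
  push_cast
  -- re-index along `ZMod (p^(0+1)) ≃+* ZMod p`
  have hpe : p ^ (0 + 1) = p := by rw [zero_add, pow_one]
  refine Fintype.sum_equiv (ZMod.ringEquivCongr hpe).toEquiv _ _ fun b ↦ ?_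
  rw [RingEquiv.toEquiv_eq_coe, EquivLike.coe_coe, ZMod.ringEquivCongr_val]

/-- **STEP B⁻(2) — the first coefficient of Disegni's line function, ODD branch.** `p ≡ 3 (mod 4)`; `V, V′` globally
minimal, good ordinary at `p` with the same `a_p`, newforms `f, f′`; `f_E` a newform with
`a_n(f_E) = (n/p)a_n(f)`; `a_n(f′) = κ_K(n)a_n(f)`; `G` Disegni's line function for `(f_E, K, α = unitRoot V p)`
(`CycLineInterpolation`); Artin formalism `hArt`. If the MINUS `ω^{(p−1)/2}`-branch of `f` vanishes at `T = 0`,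
then `[T¹]G = ι⁻¹(−u·Car·Ω⁻_f·Ω⁻_{f′}) · ι([T¹]B⁻_f) · ι(B⁻_{f′}(0))` (minus branches).
[cite: Disegni2017, Theorem A, Lemma 10.2.1–10.2.2 (arXiv v3 PDF 7–8, 68)]
[cite: MazurTateTeitelbaum1986Invent, §I.11, §I.14 (14.3)] -/
theorem coeff_one_cycLine_eq_odd (hp4 : p % 4 = 3)
    (hArt : rankinSelbergEulerProductHecke_baseChangeDirichlet_eq)
    (h2 : Module.finrank ℚ K = 2) (κ : DirichletCharacter ℂ (NumberField.discr K).natAbs)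
    (hκ : ∀ ℓ : ℕ, ℓ.Prime → ℓ ≠ 2 → κ ℓ = (jacobiSym (NumberField.discr K) ℓ : ℂ))
    (hκ2 : κ 2 = if NumberField.discr K % 8 = 1 then 1
        else if NumberField.discr K % 8 = 5 then -1 else 0)
    (hpd : Nat.Coprime p (NumberField.discr K).natAbs)
    (V V' : WeierstrassCurve ℚ) [V.IsElliptic] [V.IsGloballyMinimal] [V'.IsElliptic] [V'.IsGloballyMinimal]
    (hordV : IsOrdinaryAt V p) (hordV' : IsOrdinaryAt V' p) (hap : V'.frobeniusTrace p = V.frobeniusTrace p)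
    {N NE N' : ℕ} [NeZero N] [NeZero NE] [NeZero N'] {f : CuspForm (Gamma0 N) 2}
    {fE : CuspForm (Gamma0 NE) 2} {f' : CuspForm (Gamma0 N') 2}
    (hfV : IsNewformOf V f) (hfE : IsNewform0 fE) (hfV' : IsNewformOf V' f')
    (hE : ∀ n : ℕ, cuspCoeff fE n = (legendreSym p (n : ℤ) : ℂ) * cuspCoeff f n)
    (hV' : ∀ n : ℕ, cuspCoeff f' n = κ (n : ZMod (NumberField.discr K).natAbs) * cuspCoeff f n)
    {Car : ℝ} {G : PowerSeries ℂ_[p]}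
    (hG : CycLineInterpolation ι K fE (unitRoot V p : ℚ_[p]) Car G)
    (hB0 : PowerSeries.constantCoeff (padicLFunctionMinusBranch f (unitRoot V p : ℚ_[p]) (p / 2)) = 0) :
    PowerSeries.coeff 1 G =
      ((ι.symm (-(splitLocalConstant p : ℂ) * (Car : ℂ) * (minusPeriod f : ℂ) * (minusPeriod f' : ℂ)) :
          PadicAlgCl p) : ℂ_[p]) *
        algebraMap ℚ_[p] ℂ_[p]
          (PowerSeries.coeff 1 (padicLFunctionMinusBranch f (unitRoot V p : ℚ_[p]) (p / 2))) *
        algebraMap ℚ_[p] ℂ_[p]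
          (PowerSeries.constantCoeff (padicLFunctionMinusBranch f' (unitRoot V' p : ℚ_[p]) (p / 2))) := by
  have hpP : p.Prime := hp.out
  have hp2 : p ≠ 2 := by intro h; rw [h] at hp4; norm_num at hp4
  have he1 : cyclotomicExponent p = 1 := cyclotomicExponent_eq_one p hp2
  have hα' : unitRoot V' p = unitRoot V p := unitRoot_eq_of_frobeniusTrace_eq hap
  set c : ℂ_[p] := ((ι.symm (-(splitLocalConstant p : ℂ) * (Car : ℂ) * (minusPeriod f : ℂ) *
    (minusPeriod f' : ℂ)) : PadicAlgCl p) : ℂ_[p]) with hc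
  set B₁ := padicLFunctionMinusBranch f (unitRoot V p : ℚ_[p]) (p / 2) with hB₁
  set B₂ := padicLFunctionMinusBranch f' (unitRoot V' p : ℚ_[p]) (p / 2) with hB₂
  -- boundedness
  obtain ⟨CG, hCG⟩ := hG.isLineFunction.1
  obtain ⟨C₁, hC₁⟩ := exists_norm_coeff_padicLFunctionMinusBranch_le_of_isNewformOf hordV hfV (p / 2)
  obtain ⟨C₂, hC₂⟩ := exists_norm_coeff_padicLFunctionMinusBranch_le_of_isNewformOf hordV' hfV' (p / 2)
  have hM₁ : MemIwasawaRat p B₁ := memIwasawaRat_of_forall_norm_coeff_le hC₁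
  have hM₂ : MemIwasawaRat p B₂ := memIwasawaRat_of_forall_norm_coeff_le hC₂
  -- the pointwise statement at a twin, for every typed `θ` mod `p^{m+1}`
  have hpt : ∀ (m : ℕ) (hm : cyclotomicExponent p ≤ m + 1) (θ : DirichletCharacter ℂ (p ^ (m + 1))),
      θ.Even → (∃ j : ℕ, orderOf θ = p ^ j) → (θ.IsPrimitive ∨ m = 0) →
      HasLineValueAt G
        (((θ⁻¹.ringHomComp ι.symm.toRingHom).ringHomComp (algebraMap (PadicAlgCl p) ℂ_[p]))
            (cyclotomicGenerator p : ZMod (p ^ (m + 1))) - 1)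
        (c *
          (algebraMap ℚ_[p] ℂ_[p] ((unitRoot V p : ℚ_[p])⁻¹ ^ (m + 1)) *
            ∑ b : ZMod (p ^ (m + 1)),
              ((θ⁻¹.ringHomComp ι.symm.toRingHom).ringHomComp (algebraMap (PadicAlgCl p) ℂ_[p])) b *
                algebraMap ℚ_[p] ℂ_[p] (teichWeight p (p / 2)
                  (ZMod.castHom (pow_dvd_pow p hm) (ZMod (p ^ cyclotomicExponent p)) b)) *
                (ratMinusSymbol f ((b.val : ℚ) / ((p ^ (m + 1) : ℕ) : ℚ)) : ℂ_[p])) *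
          (algebraMap ℚ_[p] ℂ_[p] ((unitRoot V p : ℚ_[p])⁻¹ ^ (m + 1)) *
            ∑ b : ZMod (p ^ (m + 1)),
              ((θ⁻¹.ringHomComp ι.symm.toRingHom).ringHomComp (algebraMap (PadicAlgCl p) ℂ_[p])) b *
                algebraMap ℚ_[p] ℂ_[p] (teichWeight p (p / 2)
                  (ZMod.castHom (pow_dvd_pow p hm) (ZMod (p ^ cyclotomicExponent p)) b)) *
                (ratMinusSymbol f' ((b.val : ℚ) / ((p ^ (m + 1) : ℕ) : ℚ)) : ℂ_[p]))) :=
    fun m hm θ heven hord hprim ↦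
      hasLineValueAt_twin_of_cycLineInterpolation_odd ι K hp4 hArt h2 κ hκ hκ2 hpd hfE hfV.1
        hfV.coeffField_eq_bot hfV'.1 hfV'.coeffField_eq_bot hE hV' hG hm θ heven hord hprim
  -- `T = 0`
  have hm0 : cyclotomicExponent p ≤ 0 + 1 := by rw [he1]
  have h0 : PowerSeries.constantCoeff G =
      c * algebraMap ℚ_[p] ℂ_[p] (PowerSeries.constantCoeff B₁) *
        algebraMap ℚ_[p] ℂ_[p] (PowerSeries.constantCoeff B₂) := by
    have h := hpt 0 hm0 1 (MulChar.one_apply isUnit_one.neg) ⟨0, by rw [orderOf_one, pow_zero]⟩ (Or.inr rfl)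
    rw [twin_one, MulChar.one_apply (isUnit_cyclotomicGenerator_cast p (0 + 1)), sub_self,
      minusBranchValue_one_eq_constantCoeff hp2 hm0 V hordV hfV] at h
    have h' := h
    rw [show (unitRoot V p : ℚ_[p]) = (unitRoot V' p : ℚ_[p]) by rw [hα']] at h'
    -- the second factor re-indexed for `f′` (same `α`)
    have h2' := minusBranchValue_one_eq_constantCoeff hp2 hm0 V' hordV' hfV'
    rw [hα'] at h2'
    rw [h2'] at h
    rw [(h.eq_constantCoeff).symm, hB₁, hB₂, hα', mul_assoc]
  -- the characters of `Γ`
  have hchar : ∀ (m : ℕ) (χ : DirichletCharacter ℂ_[p] (p ^ (m + 2))), χ.IsPrimitive → χ.Even →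
      (∃ j : ℕ, orderOf χ = p ^ j) → ∀ v₁ v₂ : ℂ_[p],
        HasSum (fun i ↦ algebraMap ℚ_[p] ℂ_[p] (PowerSeries.coeff i B₁) *
          (χ (cyclotomicGenerator p : ZMod (p ^ (m + 2))) - 1) ^ i) v₁ →
        HasSum (fun i ↦ algebraMap ℚ_[p] ℂ_[p] (PowerSeries.coeff i B₂) *
          (χ (cyclotomicGenerator p : ZMod (p ^ (m + 2))) - 1) ^ i) v₂ →
        HasSum (fun i ↦ PowerSeries.coeff i G *
          (χ (cyclotomicGenerator p : ZMod (p ^ (m + 2))) - 1) ^ i) (c * v₁ * v₂) := by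
    intro m χ hχ heven hord v₁ v₂ hv₁ hv₂
    have hfin : IsOfFinOrder χ := by
      obtain ⟨j, hj⟩ := hord
      exact orderOf_pos_iff.mp (by rw [hj]; exact pow_pos hpP.pos j)
    obtain ⟨θ, hθ⟩ := exists_eq_twin_of_isOfFinOrder ι χ hfin
    subst hθ
    have hθeven : θ.Even := (twin_even_iff ι θ).mp heven
    have hθprim : θ.IsPrimitive := (twin_isPrimitive_iff ι θ).mp hχ
    have hθord : ∃ j : ℕ, orderOf θ = p ^ j := by rwa [orderOf_twin ι θ] at hord
    have hm : cyclotomicExponent p ≤ (m + 1) + 1 := by rw [he1]; omega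
    -- the MTT values at the twin (tree interpolation theorem), identified with `v₁`, `v₂`
    have hT₁ := hasSum_coeff_padicLFunctionMinusBranch_mul_pow_of_isNewformOf hordV hfV (p / 2) (m := m + 1)
      (by rw [he1]; omega) _ hχ heven hord
    have hT₂ := hasSum_coeff_padicLFunctionMinusBranch_mul_pow_of_isNewformOf hordV' hfV' (p / 2) (m := m + 1)
      (by rw [he1]; omega) _ hχ heven hord
    have e₁ := hv₁.unique hT₁
    have e₂ := hv₂.unique hT₂
    rw [hα'] at e₂
    have h := hpt (m + 1) hm θ hθeven hθord (Or.inl hθprim)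
    rw [e₁, e₂]
    exact h
  have hmain := coeff_one_eq_of_forall_hasSum_of_bounded hCG hM₁ hM₂ c h0 hchar hB0
  rw [hmain, hB₂]

end LeadingCoeffOdd

end Summit.BirchSwinnertonDyer.Rank1Residual.Additive

end
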